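import Literature.Probability.Percolation.ArmSeparationInner
import Literature.Probability.Percolation.ArmSeparationIntRSW
import HarnessLib

/-!
# Inner separation of two arms: nothing fails around `∂Λ_m` except with small probability

Topic: Probability / Percolation; family `crit-perc` (`P = P_{1/2} = triSitePercolation half`).
The probabilistic half of Kesten's separation step at the INNER boundary (Nolin 2008, §4.4, proof
of Thm. 11 [arXiv 0711.4948: Thm. 10], internal extremities; proof of Lemma 15 [arXiv Lemma 14],
(4.16)–(4.20)): the good event `InGood m T k₀ K R₀ Kg` of `ArmSeparationInner.lean` (no failure at
the inner side `1` and both corner guards, in the twelve rotated / colour-exchanged configurations)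
fails with probability at most

  `12 · ((1 - c₂₄⁵)^{T+1} + T (1 - c_F²)^K + 2 (1 - c_F²)^{Kg})`,

uniformly in `m ≥ 8` — the three terms being the BK tail of the exploration sequence
(`HalfAnnulus.real_lowestSeq_intDom_ne_none_le`, `ArmSeparationIntRSW.lean`), the union bound for
middle tips (`real_intSeqFail_le`, `ArmSeparationIntFenceBound.lean`) and the corner guards
(`real_iInter_compl_trapRSW_le`, `ArmSeparationFenceBound.lean`, with the colour symmetry of
`P_{1/2}`), transported by the rotation invariance of `P` (`real_preimage_rotConfig`). The
parameters are then chosen `T` first, `K, Kg` second, as printed ("we first choose `T` such that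
`C₃ (1-δ')^T ≤ δ/48`, and then `η` …").

## References

* P. Nolin, *Near-critical percolation in two dimensions*, Electron. J. Probab. 13 (2008), §4.4,
  proof of Lemma 15 and of Thm. 11 [arXiv 0711.4948: Lemma 14 (4.16)–(4.20), Thm. 10]. [Nolin2008]
* H. Kesten, *Scaling relations for 2D-percolation*, Comm. Math. Phys. 109 (1987), Lemma 2. [Kesten1987]
-/

noncomputable section

open MeasureTheory Set

namespace Literature.Probability.Percolation

open LatticeModels HalfAnnulus

/-- **A corner guard fails with probability `≤ (1 - c_F²)^{Kg}`** (colour symmetry of `P_{1/2}` and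
`real_iInter_compl_trapRSW_le`; `R₀ ≥ 1`). [cite: Nolin2008, §4.4 Lemma 15 (proof) (arXiv 0711.4948: Lemma 14, (4.18))] -/
theorem real_not_inGuard_le {cF : ℝ} (hcF : 0 < cF)
    (hF : ∀ (z : Site 2) (k : ℕ), 1 ≤ k → cF ≤ (triSitePercolation half).real (triFrameAt z k))
    {R₀ : ℕ} (hR₀ : 1 ≤ R₀) (Kg : ℕ) (C : Site 2) :
    (triSitePercolation half).real {χ | ¬ InGuard R₀ Kg C χ} ≤ (1 - cF ^ 2) ^ Kg := by
  have hset : {χ : SiteConfig (Site 2) | ¬ InGuard R₀ Kg C χ} =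
      compl ⁻¹' ⋂ i ∈ Finset.range Kg, (trapRSW C (trapScale R₀ i))ᶜ := by
    ext χ
    simp only [InGuard, not_exists, not_and, Set.mem_setOf_eq, Set.mem_preimage, Set.mem_iInter,
      Set.mem_compl_iff, Finset.mem_range]
  rw [hset]
  unfold triSitePercolation
  rw [sitePercolation_real_preimage_compl, symm_half]
  have h := (real_iInter_compl_trapRSW_le hcF hF C hR₀ Kg).1
  unfold triSitePercolation at h
  exact h

/-- **Failure at the inner side has small probability**: `P(InFail m T k₀ K R₀) ≤
(1 - c⁵)^{T+1} + T (1 - c_F²)^K` for `m ≥ 8`, `k₀ ≥ 1`, `2 k_j + 1 ≤ R₀` (`j < K`), where `c` is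
the RSW constant at aspect ratio `24` (`real_lowestSeq_intDom_ne_none_le`, `real_intSeqFail_le`). [cite: Nolin2008, §4.4 Lemma 15 (proof) (arXiv 0711.4948: Lemma 14, (4.17)–(4.20))] -/
theorem real_inFail_le {cF c : ℝ} (hcF : 0 < cF)
    (hF : ∀ (z : Site 2) (k : ℕ), 1 ≤ k → cF ≤ (triSitePercolation half).real (triFrameAt z k))
    (hrsw : ∀ n : ℕ, 1 ≤ ⌊(24 : ℝ) * n⌋₊ → c ≤ triLRCrossingProb half ⌊(24 : ℝ) * n⌋₊ n) (hc : 0 ≤ c)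
    {m T k₀ K R₀ : ℕ} (hm : 8 ≤ m) (hk₀ : 1 ≤ k₀) (hKR : ∀ j < K, 2 * trapScale k₀ j + 1 ≤ R₀) :
    (triSitePercolation half).real {χ | InFail m T k₀ K R₀ χ} ≤ (1 - c ^ 5) ^ (T + 1) + T * (1 - cF ^ 2) ^ K := by
  have h1 := real_lowestSeq_intDom_ne_none_le hrsw hc hm T
  have h2 := real_intSeqFail_le hcF hF (m := m) (T := T) (by omega) hk₀ hKR
  have hsub : {χ : SiteConfig (Site 2) | InFail m T k₀ K R₀ χ} ⊆
      {ω | (intDom m).lowestSeq ω T ≠ none} ∪ {ω | IntSeqFail m T k₀ K R₀ ω} := fun χ hχ => hχ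
  calc (triSitePercolation half).real {χ | InFail m T k₀ K R₀ χ}
      ≤ (triSitePercolation half).real ({ω | (intDom m).lowestSeq ω T ≠ none} ∪ {ω | IntSeqFail m T k₀ K R₀ ω}) :=
        measureReal_mono hsub
    _ ≤ _ := measureReal_union_le _ _
    _ ≤ _ := add_le_add h1 h2

/-- The bad event of one configuration: failure or a missing guard. [folklore] -/
def inBad (m T k₀ K R₀ Kg : ℕ) : Set (SiteConfig (Site 2)) :=
  {χ | InFail m T k₀ K R₀ χ ∨ ¬ InGuard R₀ Kg ![(m : ℤ), -(m : ℤ)] χ ∨ ¬ InGuard R₀ Kg ![(m : ℤ), 0] χ}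

/-- `P(inBad) ≤ (1 - c⁵)^{T+1} + T (1 - c_F²)^K + 2 (1 - c_F²)^{Kg}`. [cite: Nolin2008, §4.4 Lemma 15 (proof) (arXiv 0711.4948: Lemma 14, (4.20))] -/
theorem real_inBad_le {cF c : ℝ} (hcF : 0 < cF)
    (hF : ∀ (z : Site 2) (k : ℕ), 1 ≤ k → cF ≤ (triSitePercolation half).real (triFrameAt z k))
    (hrsw : ∀ n : ℕ, 1 ≤ ⌊(24 : ℝ) * n⌋₊ → c ≤ triLRCrossingProb half ⌊(24 : ℝ) * n⌋₊ n) (hc : 0 ≤ c)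
    {m T k₀ K R₀ Kg : ℕ} (hm : 8 ≤ m) (hk₀ : 1 ≤ k₀) (hR₀ : 1 ≤ R₀) (hKR : ∀ j < K, 2 * trapScale k₀ j + 1 ≤ R₀) :
    (triSitePercolation half).real (inBad m T k₀ K R₀ Kg) ≤
      (1 - c ^ 5) ^ (T + 1) + T * (1 - cF ^ 2) ^ K + 2 * (1 - cF ^ 2) ^ Kg := by
  have h1 := real_inFail_le hcF hF hrsw hc (T := T) hm hk₀ hKR
  have h2 := real_not_inGuard_le hcF hF hR₀ Kg ![(m : ℤ), -(m : ℤ)]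
  have h3 := real_not_inGuard_le hcF hF hR₀ Kg ![(m : ℤ), 0]
  have hset : inBad m T k₀ K R₀ Kg = {χ | InFail m T k₀ K R₀ χ} ∪
      ({χ | ¬ InGuard R₀ Kg ![(m : ℤ), -(m : ℤ)] χ} ∪ {χ | ¬ InGuard R₀ Kg ![(m : ℤ), 0] χ}) := by
    ext χ; simp only [inBad, Set.mem_setOf_eq, Set.mem_union]
  rw [hset]
  calc (triSitePercolation half).real ({χ | InFail m T k₀ K R₀ χ} ∪
        ({χ | ¬ InGuard R₀ Kg ![(m : ℤ), -(m : ℤ)] χ} ∪ {χ | ¬ InGuard R₀ Kg ![(m : ℤ), 0] χ}))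
      ≤ (triSitePercolation half).real {χ | InFail m T k₀ K R₀ χ} +
          (triSitePercolation half).real ({χ | ¬ InGuard R₀ Kg ![(m : ℤ), -(m : ℤ)] χ} ∪
            {χ | ¬ InGuard R₀ Kg ![(m : ℤ), 0] χ}) := measureReal_union_le _ _
    _ ≤ (triSitePercolation half).real {χ | InFail m T k₀ K R₀ χ} +
          ((triSitePercolation half).real {χ | ¬ InGuard R₀ Kg ![(m : ℤ), -(m : ℤ)] χ} +
            (triSitePercolation half).real {χ | ¬ InGuard R₀ Kg ![(m : ℤ), 0] χ}) :=
        add_le_add le_rfl (measureReal_union_le _ _)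
    _ ≤ _ := by linarith

/-- Off `InGood`, one of the twelve configurations is bad. [folklore] -/
theorem not_inGood_subset (m T k₀ K R₀ Kg : ℕ) :
    {ω : SiteConfig (Site 2) | ¬ InGood m T k₀ K R₀ Kg ω} ⊆
      ⋃ i ∈ Finset.range 6, (rotConfig i ⁻¹' inBad m T k₀ K R₀ Kg ∪ rotConfig i ⁻¹' (compl ⁻¹' inBad m T k₀ K R₀ Kg)) := by
  intro ω hω
  simp only [Set.mem_setOf_eq, InGood, not_forall] at hω
  obtain ⟨i, hi, h⟩ := hω
  simp only [Set.mem_iUnion, Set.mem_union, Set.mem_preimage, Finset.mem_range]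
  refine ⟨i, hi, ?_⟩
  by_contra hno
  simp only [not_or] at hno
  obtain ⟨h1, h2⟩ := hno
  simp only [inBad, Set.mem_setOf_eq, not_or, not_not] at h1 h2
  exact h ⟨⟨h1.1, h1.2.1, h1.2.2⟩, ⟨h2.1, h2.2.1, h2.2.2⟩⟩

/-- **Nothing fails around `∂Λ_m` except with small probability** (Nolin 2008, proof of Thm. 11
with Lemma 15, internal extremities, `j = 2`): for `m ≥ 8`, `k₀, R₀ ≥ 1` and `2 k_j + 1 ≤ R₀`
(`j < K`),
`P(¬ InGood m T k₀ K R₀ Kg) ≤ 12 · ((1 - c⁵)^{T+1} + T (1 - c_F²)^K + 2 (1 - c_F²)^{Kg})`,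
where `c_F` is the frame constant (`exists_pos_le_real_triFrameAt`) and `c` the RSW constant at
aspect ratio `24`; the bound does not depend on `m`, and is made small by choosing `T` first, then
`K` and `Kg`. [cite: Nolin2008, §4.4 Lemma 15 and Thm. 11 (proof) (arXiv 0711.4948: Lemma 14 (4.20), Thm. 10)] -/
theorem real_not_inGood_le {cF c : ℝ} (hcF : 0 < cF)
    (hF : ∀ (z : Site 2) (k : ℕ), 1 ≤ k → cF ≤ (triSitePercolation half).real (triFrameAt z k))
    (hrsw : ∀ n : ℕ, 1 ≤ ⌊(24 : ℝ) * n⌋₊ → c ≤ triLRCrossingProb half ⌊(24 : ℝ) * n⌋₊ n) (hc : 0 ≤ c)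
    {m T k₀ K R₀ Kg : ℕ} (hm : 8 ≤ m) (hk₀ : 1 ≤ k₀) (hR₀ : 1 ≤ R₀) (hKR : ∀ j < K, 2 * trapScale k₀ j + 1 ≤ R₀) :
    (triSitePercolation half).real {ω | ¬ InGood m T k₀ K R₀ Kg ω} ≤
      12 * ((1 - c ^ 5) ^ (T + 1) + T * (1 - cF ^ 2) ^ K + 2 * (1 - cF ^ 2) ^ Kg) := by
  set B := inBad m T k₀ K R₀ Kg with hB
  set ε := (1 - c ^ 5) ^ (T + 1) + T * (1 - cF ^ 2) ^ K + 2 * (1 - cF ^ 2) ^ Kg with hε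
  have hbad : (triSitePercolation half).real B ≤ ε := real_inBad_le hcF hF hrsw hc hm hk₀ hR₀ hKR
  have hrot : ∀ i : ℕ, (triSitePercolation half).real (rotConfig i ⁻¹' B) ≤ ε := fun i => by
    rw [real_preimage_rotConfig]; exact hbad
  have hrotc : ∀ i : ℕ, (triSitePercolation half).real (rotConfig i ⁻¹' (compl ⁻¹' B)) ≤ ε := fun i => by
    rw [real_preimage_rotConfig]
    unfold triSitePercolation
    rw [sitePercolation_real_preimage_compl, symm_half]
    exact hbad
  calc (triSitePercolation half).real {ω | ¬ InGood m T k₀ K R₀ Kg ω}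
      ≤ (triSitePercolation half).real
          (⋃ i ∈ Finset.range 6, (rotConfig i ⁻¹' B ∪ rotConfig i ⁻¹' (compl ⁻¹' B))) :=
        measureReal_mono (not_inGood_subset m T k₀ K R₀ Kg) (measure_ne_top _ _)
    _ ≤ ∑ i ∈ Finset.range 6, (triSitePercolation half).real (rotConfig i ⁻¹' B ∪ rotConfig i ⁻¹' (compl ⁻¹' B)) :=
        measureReal_biUnion_finset_le _ _
    _ ≤ ∑ i ∈ Finset.range 6, (ε + ε) := Finset.sum_le_sum fun i _ =>
        (measureReal_union_le _ _).trans (add_le_add (hrot i) (hrotc i))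
    _ = 12 * ε := by rw [Finset.sum_const, Finset.card_range, nsmul_eq_mul]; push_cast; ring

end Literature.Probability.Percolation
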